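import Summits.ResolutionOfSingularities.ResolutionOfSingularities.Theorems.FrobeniusClosingClosingLemmaClosingRound
import Summits.ResolutionOfSingularities.ResolutionOfSingularities.Theorems.FrobeniusClosingClosingLemmaLimitRound
import Summits.ResolutionOfSingularities.ResolutionOfSingularities.Theses.FrobeniusClosing
import Mathlib.RingTheory.Ideal.Height
import Mathlib.RingTheory.Ideal.KrullsHeightTheorem
import Mathlib.RingTheory.KrullDimension.Polynomial
import Mathlib.RingTheory.KrullDimension.Field
import Mathlib.FieldTheory.IsAlgClosed.AlgebraicClosure
import HarnessLib

/-!
# Route `FrobeniusClosing`, support item `ClosingLemma` (stmt-ResolutionOfSingularities-16348) —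
# PROVED conditionally on the twisted Lang–Weil estimate (Varshavsky 2018, Cor. 2)

`ClosingLemma`: a constructible arena `T = ⋃ⱼ V(Par j) ∖ V(g)` (`g ∈ Qar j`) in `𝔸ᴺ × 𝔸ᴺ` over
`𝔽_p` that has an infinite path over SOME field of characteristic `p` has a PERIODIC path over some
FINITE field.  `closingLemma_of_cor2_affine : Varshavsky2014.cor2_affine → ClosingLemma` — the
only input that is not proved in the tree is the vendored named fact
`Literature.NumberTheory.DiophantineGeometry.Varshavsky2014.cor2_affine` (Varshavsky, *Intersection
of a correspondence with a graph of Frobenius*, J. Algebraic Geom. 27 (2018), Cor. 2 = Hrushovski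
2004, Cor. 1.2), a deep published theorem; so the item is settled MODULO that printed theorem
(a conditional result in the gate's sense).

Proof (walks of loci; replaces the survivor-set induction of the route card, cf. the two proof
plans attached to the item as evidence):
* ROUND 0 (`closingLemma_of_cor2_affine`): embed the path into an algebraic closure `Ω ⊇ K`, which
  is an algebra over `F = 𝔽̄_p`; the loci `P m = I({w m}) ⊆ F[x]`, `Q m = I({(w m, w (m+1))})` form
  a walk (`ClosingRound` format), all of height `≤ N = dim F[x]`.
* INDUCTION on a height bound (`periodic_path_of_walk`): if a vertex prime repeats, the closing
  round `periodic_path_of_repeat` (cyclic product correspondence + Cor. 2 + Frobenius iteration)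
  gives the periodic path; otherwise the limit round `exists_limit_walk` produces a walk with
  strictly smaller primes, hence strictly smaller heights (`Ideal.height_strict_mono_of_isPrime`),
  impossible below height `0`.

OURS (campaign res-hironaka, rung L, slot W4.1: input `hCL` of the K(3) line of chain W4.1).
[folklore]
-/

noncomputable section

-- single-problem summit: the doubled namespace component `ResolutionOfSingularities` is forced
set_option linter.dupNamespace false

open MvPolynomial
open Literature.NumberTheory.DiophantineGeometry.Varshavsky2014 (cor2_affine)
open Summit.ResolutionOfSingularities.ResolutionOfSingularities.Theses.FrobeniusClosing (ClosingLemma)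

namespace Summit.ResolutionOfSingularities.ResolutionOfSingularities.Theorems.FrobeniusClosing.ClosingArena

/-- `dim F[x₁, …, x_N] = N`. [folklore] -/
theorem ringKrullDim_mvPolynomial_fin (F : Type*) [Field F] (N : ℕ) :
    ringKrullDim (MvPolynomial (Fin N) F) = N := by
  rw [MvPolynomial.ringKrullDim_of_isNoetherianRing, ringKrullDim_eq_zero_of_field]
  simp

/-- **All rounds at once (conditional on `cor2_affine`)**: every walk of loci of the arena over an
algebraic closure of `ZMod p` whose vertex primes have height `≤ h` yields a periodic arena path
over a finite field — by induction on `h`: a repeated vertex prime is the closing round, pairwise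
distinct vertex primes admit a limit round with strictly smaller heights. [folklore] -/
theorem periodic_path_of_walk (hcor2 : cor2_affine) (p : ℕ) [Fact p.Prime] (F : Type) [Field F]
    [Algebra (ZMod p) F] [IsAlgClosed F] [Algebra.IsAlgebraic (ZMod p) F] {N k : ℕ}
    (Par Qar : Fin k → Finset (MvPolynomial (Fin N ⊕ Fin N) (ZMod p))) :
    ∀ (h : ℕ) (P : ℕ → Ideal (MvPolynomial (Fin N) F))
      (Q : ℕ → Ideal (MvPolynomial (Fin N ⊕ Fin N) F)) (j : ℕ → Fin k)
      (g : ℕ → MvPolynomial (Fin N ⊕ Fin N) F),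
      (∀ m, (P m).IsPrime) → (∀ m, (Q m).IsPrime) →
      (∀ m f, rename Sum.inl f ∈ Q m ↔ f ∈ P m) →
      (∀ m f, rename Sum.inr f ∈ Q m ↔ f ∈ P (m + 1)) →
      (∀ m, (map (algebraMap (ZMod p) F)) ''
        ((Par (j m) : Finset (MvPolynomial (Fin N ⊕ Fin N) (ZMod p))) : Set _) ⊆
        (Q m : Set (MvPolynomial (Fin N ⊕ Fin N) F))) →
      (∀ m, g m ∈ (map (algebraMap (ZMod p) F)) ''
        ((Qar (j m) : Finset (MvPolynomial (Fin N ⊕ Fin N) (ZMod p))) : Set _) ∧ g m ∉ Q m) →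
      (∀ m, (P m).height ≤ h) →
      ∃ (K : Type) (_ : Field K) (_ : Algebra (ZMod p) K) (_ : Finite K) (w : ℕ → Fin N → K)
        (R : ℕ), 0 < R ∧ (∀ m, w (m + R) = w m) ∧
        ∀ m, ∃ j, (∀ f ∈ Par j, MvPolynomial.aeval (Sum.elim (w m) (w (m + 1))) f = 0) ∧
          ∃ g ∈ Qar j, MvPolynomial.aeval (Sum.elim (w m) (w (m + 1))) g ≠ 0 := by
  classical
  -- the limit round in the present format
  have limit : ∀ (P : ℕ → Ideal (MvPolynomial (Fin N) F))
      (Q : ℕ → Ideal (MvPolynomial (Fin N ⊕ Fin N) F)) (j : ℕ → Fin k)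
      (g : ℕ → MvPolynomial (Fin N ⊕ Fin N) F),
      (∀ m, (P m).IsPrime) → (∀ m, (Q m).IsPrime) →
      (∀ m f, rename Sum.inl f ∈ Q m ↔ f ∈ P m) →
      (∀ m f, rename Sum.inr f ∈ Q m ↔ f ∈ P (m + 1)) →
      (∀ m, (map (algebraMap (ZMod p) F)) ''
        ((Par (j m) : Finset (MvPolynomial (Fin N ⊕ Fin N) (ZMod p))) : Set _) ⊆
        (Q m : Set (MvPolynomial (Fin N ⊕ Fin N) F))) →
      (∀ m, g m ∈ (map (algebraMap (ZMod p) F)) ''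
        ((Qar (j m) : Finset (MvPolynomial (Fin N ⊕ Fin N) (ZMod p))) : Set _) ∧ g m ∉ Q m) →
      Function.Injective P →
      ∃ (P' : ℕ → Ideal (MvPolynomial (Fin N) F))
        (Q' : ℕ → Ideal (MvPolynomial (Fin N ⊕ Fin N) F)) (j' : ℕ → Fin k)
        (g' : ℕ → MvPolynomial (Fin N ⊕ Fin N) F),
        (∀ m, (P' m).IsPrime) ∧ (∀ m, (Q' m).IsPrime) ∧
        (∀ m f, rename Sum.inl f ∈ Q' m ↔ f ∈ P' m) ∧
        (∀ m f, rename Sum.inr f ∈ Q' m ↔ f ∈ P' (m + 1)) ∧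
        (∀ m, (map (algebraMap (ZMod p) F)) ''
          ((Par (j' m) : Finset (MvPolynomial (Fin N ⊕ Fin N) (ZMod p))) : Set _) ⊆
          (Q' m : Set (MvPolynomial (Fin N ⊕ Fin N) F))) ∧
        (∀ m, g' m ∈ (map (algebraMap (ZMod p) F)) ''
          ((Qar (j' m) : Finset (MvPolynomial (Fin N ⊕ Fin N) (ZMod p))) : Set _) ∧
          g' m ∉ Q' m) ∧
        (∀ m, ∃ n, P' m < P n) := by
    intro P Q j g hP hQ h1 h2 h3 h4 hinj
    obtain ⟨P', Q', j', g', hP', hQ', h1', h2', h3', h4', hlt⟩ :=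
      exists_limit_walk ((rename Sum.inl : MvPolynomial (Fin N) F →ₐ[F] _).toRingHom)
        ((rename Sum.inr : MvPolynomial (Fin N) F →ₐ[F] _).toRingHom)
        (fun jj => (map (algebraMap (ZMod p) F)) ''
          ((Par jj : Finset (MvPolynomial (Fin N ⊕ Fin N) (ZMod p))) : Set _))
        (fun jj => (Qar jj).image (map (algebraMap (ZMod p) F))) P Q j g hP hQ
        (fun m f => h1 m f) (fun m f => h2 m f) h3
        (fun m => ⟨by rw [← Finset.mem_coe, Finset.coe_image]; exact (h4 m).1, (h4 m).2⟩) hinj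
    refine ⟨P', Q', j', g', hP', hQ', fun m f => h1' m f, fun m f => h2' m f, h3', fun m =>
      ⟨?_, (h4' m).2⟩, hlt⟩
    have := (h4' m).1
    rwa [← Finset.mem_coe, Finset.coe_image] at this
  intro h
  induction h with
  | zero =>
    intro P Q j g hP hQ h1 h2 h3 h4 hh
    by_cases hinj : Function.Injective P
    · exfalso
      obtain ⟨P', Q', j', g', hP', -, -, -, -, -, hlt⟩ := limit P Q j g hP hQ h1 h2 h3 h4 hinj
      obtain ⟨n, hn⟩ := hlt 0
      haveI := hP' 0
      haveI := hP n
      have hlt' := Ideal.height_strict_mono_of_isPrime hn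
      have := lt_of_lt_of_le hlt' (hh n)
      simp at this
    · rw [Function.Injective] at hinj
      push Not at hinj
      obtain ⟨a, b, hPab, hab⟩ := hinj
      rcases lt_or_gt_of_ne hab with hlt | hlt
      · exact periodic_path_of_repeat hcor2 p F Par Qar P Q j g hP hQ h1 h2 h3 h4 hlt hPab
      · exact periodic_path_of_repeat hcor2 p F Par Qar P Q j g hP hQ h1 h2 h3 h4 hlt hPab.symm
  | succ h ih =>
    intro P Q j g hP hQ h1 h2 h3 h4 hh
    by_cases hinj : Function.Injective P
    · obtain ⟨P', Q', j', g', hP', hQ', h1', h2', h3', h4', hlt⟩ :=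
        limit P Q j g hP hQ h1 h2 h3 h4 hinj
      refine ih P' Q' j' g' hP' hQ' h1' h2' h3' h4' fun m => ?_
      obtain ⟨n, hn⟩ := hlt m
      haveI := hP' m
      haveI := hP n
      have hlt' := Ideal.height_strict_mono_of_isPrime hn
      have h' : (P' m).height < (h : ℕ∞) + 1 := by
        have := lt_of_lt_of_le hlt' (hh n)
        exact_mod_cast this
      exact Order.le_of_lt_add_one h'
    · rw [Function.Injective] at hinj
      push Not at hinj
      obtain ⟨a, b, hPab, hab⟩ := hinj
      rcases lt_or_gt_of_ne hab with hlt | hlt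
      · exact periodic_path_of_repeat hcor2 p F Par Qar P Q j g hP hQ h1 h2 h3 h4 hlt hPab
      · exact periodic_path_of_repeat hcor2 p F Par Qar P Q j g hP hQ h1 h2 h3 h4 hlt hPab.symm

/-- **`ClosingLemma` (route `FrobeniusClosing`, support item stmt-ResolutionOfSingularities-16348)
holds conditionally on the twisted Lang–Weil estimate `Varshavsky2014.cor2_affine`** (Varshavsky
2018, Cor. 2 = Hrushovski 2004, Cor. 1.2 — vendored named fact; the hypothesis is the theorem's only
unproved input).  Round 0: the loci over `𝔽̄_p` of the given path, read in an algebraic closure of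
the given field. [cite: Varshavsky2014, Cor. 2] [cite: Hrushovski2004, Cor. 1.2] -/
theorem closingLemma_of_cor2_affine (hcor2 : cor2_affine) : ClosingLemma := by
  classical
  intro p hp N k Par Qar hpath
  obtain ⟨K, iK, iA, w, hw⟩ := hpath
  haveI : Fact p.Prime := ⟨hp⟩
  -- the fields: `F = 𝔽̄_p`, `Ω = K̄`, `F → Ω`
  let F : Type := AlgebraicClosure (ZMod p)
  let Ω : Type := AlgebraicClosure K
  let ιF : F →ₐ[ZMod p] Ω := IsAlgClosed.lift
  letI : Algebra F Ω := ιF.toRingHom.toAlgebra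
  haveI : IsScalarTower (ZMod p) F Ω :=
    IsScalarTower.of_algebraMap_eq fun x => (ιF.commutes x).symm
  -- the path in `Ω` and its loci over `F`
  let wΩ : ℕ → Fin N → Ω := fun m s => algebraMap K Ω (w m s)
  have hpair : ∀ m, (⇑(algebraMap K Ω) ∘ Sum.elim (w m) (w (m + 1))) =
      Sum.elim (wΩ m) (wΩ (m + 1)) := by
    intro m; funext s; rcases s with s | s <;> rfl
  have htr : ∀ m (f : MvPolynomial (Fin N ⊕ Fin N) (ZMod p)),
      aeval (Sum.elim (wΩ m) (wΩ (m + 1))) f =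
        algebraMap K Ω (aeval (Sum.elim (w m) (w (m + 1))) f) := by
    intro m f
    rw [← aeval_algebraMap_apply, hpair]
  choose j hj using hw
  have hgg : ∀ m, ∃ g ∈ Qar (j m), aeval (Sum.elim (w m) (w (m + 1))) g ≠ 0 := fun m => (hj m).2
  choose gg hgg hggne using hgg
  refine periodic_path_of_walk hcor2 p F Par Qar N
    (fun m => vanishingIdeal F ({wΩ m} : Set (Fin N → Ω)))
    (fun m => vanishingIdeal F ({Sum.elim (wΩ m) (wΩ (m + 1))} : Set (Fin N ⊕ Fin N → Ω)))
    j (fun m => map (algebraMap (ZMod p) F) (gg m))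
    (fun m => inferInstance) (fun m => inferInstance) ?_ ?_ ?_ ?_ ?_
  · -- first projection
    intro m f
    rw [mem_vanishingIdeal_singleton_iff, mem_vanishingIdeal_singleton_iff, aeval_rename,
      Sum.elim_comp_inl]
  · -- second projection
    intro m f
    rw [mem_vanishingIdeal_singleton_iff, mem_vanishingIdeal_singleton_iff, aeval_rename,
      Sum.elim_comp_inr]
  · -- closed arena conditions
    rintro m _ ⟨f, hf, rfl⟩
    show map (algebraMap (ZMod p) F) f ∈ vanishingIdeal F ({Sum.elim (wΩ m) (wΩ (m + 1))} : Set _)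
    rw [mem_vanishingIdeal_singleton_iff, aeval_map_algebraMap, htr, (hj m).1 f hf, map_zero]
  · -- open arena condition
    intro m
    refine ⟨⟨gg m, hgg m, rfl⟩, fun hmem => hggne m ?_⟩
    have h0 : aeval (Sum.elim (wΩ m) (wΩ (m + 1))) (map (algebraMap (ZMod p) F) (gg m)) = 0 :=
      (mem_vanishingIdeal_singleton_iff _ _).1 hmem
    rw [aeval_map_algebraMap, htr] at h0
    exact (algebraMap K Ω).injective (by rw [h0, map_zero])
  · -- heights
    intro m
    have hle := Ideal.height_le_ringKrullDim_of_isPrime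
      (I := vanishingIdeal F ({wΩ m} : Set (Fin N → Ω)))
    rw [ringKrullDim_mvPolynomial_fin] at hle
    exact_mod_cast hle

end Summit.ResolutionOfSingularities.ResolutionOfSingularities.Theorems.FrobeniusClosing.ClosingArena

end
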